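import Literature.AlgebraicGeometry.HodgeTheory.PolarizedLimitMixedHodgeStructureRescaledLimit
import HarnessLib

/-!
# Fixed metric versus Hodge metric along the nilpotent orbit (polynomial distortion), and the transfer of an approximate
# Hodge class from a far point `θ(z)` to the bounded point `θ(Re z + iA)` (Cattani–Deligne–Kaplan, 2.16 Remark (ii) and 4.9, `d = 1`)

Topic `Literature/AlgebraicGeometry/HodgeTheory` (namespace `…HodgeTheory.PolarizedLimitMixedHodgeStructure`).  Theorems only; no
definition, no instance, no named fact (D-0026 net debt `0`).

PRINTED SOURCE, VERBATIM. E. Cattani, P. Deligne, A. Kaplan, *On the locus of Hodge classes*, J. Amer. Math. Soc. 8 (1995) 483–506.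
**2.16, Remark (ii)** (p. 492): «In (2.16.1), we use the Hodge metric at `Φ(z)`. We could as well have used a fixed metric. Indeed,
the ratio between a fixed metric and the Hodge metric is bounded by a power of `sup(y_j)` (see (3.8 (i))) so that for any `α' < α` and
for `inf(y_j)` large enough, `v ∼_z Φ⁰(z)` for `α` and one metric implies `v ∼_z Φ⁰(z)` for `α'` and the other metric.»  **2.18**
(p. 492): «`exp(Σ z_jN_j)` is of size `sup(y_j)^k`, `k` bounded by the rank of `𝒱`.»  **4.9** (p. 505): «With angles measured using a
fixed metric, we have `u(n) ∼_z Φ⁰(z(n))`. Applying `exp(−iτ₁(n)T₁)`, of polynomial size in `sup_i(y_i(n))`: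
`exp(−iτ₁(n)T₁)u(n) ∼_z Φ⁰(z(n) − iτ₁(n)θ¹)` and, by 4.8, `u(n) ∼_z Φ⁰(z(n) − iτ₁(n)θ¹)`. If `d = 1`, we choose the expansion
(4.1.3) (subtracting a constant to `τ₁(n)`) so that `y(n) − τ₁(n)θ₁ ≥ A > 0`. … Moreover, `z(n) − iτ₁(n)θ¹` remains bounded and the
corresponding Hodge filtrations remain in a compact set.»

THE TREE'S SETTING. `L = (W, F, N, Q)` a polarized limit mixed Hodge structure of weight `k` on the finite-dimensional `ℚ`-space `V`,
`θ(z) = exp(zN)·F` its nilpotent orbit (a pure Hodge structure polarized by `Q` for `Im z > β = L.normThreshold`, Hodge norm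
`‖·‖_{θ(z)}`), `|·|₀ = ‖·‖_{F̂_♯}` the FIXED reference norm (`referenceNorm`), `π̂_m` the projections of the `δ`-grading; the tree's norm
estimates `½ (Im z)^{(m−k)/2} |π̂_m v|₀ ≤ ‖exp((Re z)N) v‖_{θ(z)} ≤ (3/2) (Im z)^{(l−k)/2} |v|₀` (`v ∈ W_{l,ℂ}`).

WHAT IS FORMALIZED.
* §1 «`exp(zN)` is of polynomial size»: in the fixed norm, **`|exp(cN) w|₀ ≤ M (1 + |c|)^d |w|₀`** and
  **`|exp(cN) w − w|₀ ≤ M |c| (1 + |c|)^d |N w|₀`** for all `c ∈ ℂ`, `w ∈ V_ℂ` (`exists_referenceNorm_exp_smul_N_le`,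
  `exists_referenceNorm_exp_smul_N_sub_le`); hence `exp(cN) w = w` when `N w = 0`.
* §2 «the ratio between a fixed metric and the Hodge metric is bounded by a power of `y`»: for `|Re z| ≤ R`, `Im z > β`:
  **`‖w‖_{θ(z)} ≤ B (Im z)^n |w|₀`** and **`|w|₀ ≤ B (Im z)^n ‖w‖_{θ(z)}`** for all `w` (`exists_forall_hodgeNorm_nilpotentOrbit_le_pow_mul_referenceNorm`,
  `exists_forall_referenceNorm_le_pow_mul_hodgeNorm_nilpotentOrbit`; constants depending on `L` and `R`).  In particular at the bounded
  points `z' = x₀ + iA`, `|x₀| ≤ R`, the two norms are uniformly equivalent («the corresponding Hodge filtrations remain in a compact set»).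
* §3 THE TRANSFER (4.9 at `d = 1`): `θ(z')^p = exp((z' − z)N)·θ(z)^p` (`nilpotentOrbit_F_eq_map_exp_sub`); for `|Re z| ≤ R`, `Re z' = Re z`,
  `0 < Im z' ≤ Im z` and every `x`, `f ∈ V_ℂ`: **`|x − exp((z' − z)N) f|₀ ≤ B (Im z)^n (‖x − f‖_{θ(z)} + ‖N x‖_{θ(z)})`**
  (`exists_forall_referenceNorm_sub_exp_apply_le`) — a vector `‖x − f‖_{θ(z)}`-close to `f ∈ F^pθ(z)` with `‖N x‖_{θ(z)}` small
  («by 4.8») is, in the fixed metric and up to a polynomial factor, close to `exp((z' − z)N) f ∈ F^pθ(z')`.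
* §4 the same towards the LIMIT filtration for `N`-invariant vectors: `N x = 0`, `f ∈ F^pθ(z)` ⟹ `exp(−zN) f ∈ F^p` and
  **`|x − exp(−zN) f|₀ ≤ B (Im z)^n ‖x − f‖_{θ(z)}`** (`exists_forall_exists_mem_F_referenceNorm_sub_le`); and `F^p` is closed for `|·|₀`
  (`mem_F_of_forall_exists_referenceNorm_sub_le`) — the route to «`v` is in `F⁰` for some limiting Hodge filtration» (2.16 (iii)).

NOT HERE: the assembly of Thm. 2.16 (finiteness through the lattice, `N u = 0`, `u ∈ F^p`) — the next file.

## References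

* [CattaniDeligneKaplan1995] E. Cattani, P. Deligne, A. Kaplan, *On the locus of Hodge classes*, J. Amer. Math. Soc. 8 (1995)
  483–506: Thm. 2.16 Remark (ii), 2.18 (p. 492), Prop. 3.8 (i), Remark 3.9 (i) (p. 498), 4.9 (p. 505).
* [CattaniKaplanSchmid1987] E. Cattani, A. Kaplan, W. Schmid, LNM 1246 (1987): §3 Cor. (3.6), Cor. (3.7).
* [Schmid1973] W. Schmid, Invent. Math. 22 (1973): Thm. (6.6) (cite only).
-/

noncomputable section

open scoped TensorProduct ComplexOrder
open Filter Topology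

namespace Literature.AlgebraicGeometry

open Module
open Motives Motives.MixedHodgeStructure
open Motives.HodgeStructure (conj conj_conj complexConj mem_complexConj)

universe u

variable {V : Type u} [AddCommGroup V] [Module ℚ V] [FiniteDimensional ℚ V] {k : ℤ}

namespace HodgeTheory

namespace PolarizedLimitMixedHodgeStructure

variable (L : PolarizedLimitMixedHodgeStructure V k)

/-! ## §0 Tools -/

/-- The total weights of the nonzero `Î^{p,q}` of the `δ`-splitting lie in a finite set. [folklore] -/
private theorem exists_weights_subset :
    ∃ s : Finset ℤ, ∀ p q : ℤ, L.deltaSplit.toMixedHodgeStructure.deligneI p q ≠ ⊥ → p + q ∈ s := by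
  classical
  refine ⟨L.deltaSplit.toMixedHodgeStructure.finite_setOf_deligneFamily_ne_bot.toFinset.image fun pq => pq.1 + pq.2,
    fun p q h => Finset.mem_image.2 ⟨(p, q), ?_, rfl⟩⟩
  rw [Set.Finite.mem_toFinset, Set.mem_setOf_eq, deligneFamily_apply]
  exact h

/-- `√y ^ e ≤ y ^ |e|` for `y ≥ 1` and an integer `e` (polynomial domination of the half-integral powers). [folklore] -/
private theorem sqrt_zpow_le_pow_natAbs {y : ℝ} (hy : 1 ≤ y) (e : ℤ) : Real.sqrt y ^ e ≤ y ^ e.natAbs := by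
  have hs1 : 1 ≤ Real.sqrt y := by rw [← Real.sqrt_one]; exact Real.sqrt_le_sqrt hy
  have hsy : Real.sqrt y ≤ y := by
    calc Real.sqrt y = Real.sqrt y * 1 := (mul_one _).symm
      _ ≤ Real.sqrt y * Real.sqrt y := mul_le_mul_of_nonneg_left hs1 (Real.sqrt_nonneg _)
      _ = y := Real.mul_self_sqrt (by linarith)
  rcases Int.natAbs_eq e with h | h
  · rw [h, Int.natAbs_natCast, zpow_natCast]
    exact pow_le_pow_left₀ (Real.sqrt_nonneg _) hsy _
  · rw [h, Int.natAbs_neg, Int.natAbs_natCast, zpow_neg, zpow_natCast]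
    calc (Real.sqrt y ^ e.natAbs)⁻¹ ≤ 1 := inv_le_one_of_one_le₀ (one_le_pow₀ hs1)
      _ ≤ y ^ e.natAbs := one_le_pow₀ hy

/-- `|N^i w|₀ ≤ a^i |w|₀` from `|N w|₀ ≤ a|w|₀`. [folklore] -/
private theorem referenceNorm_pow_N_apply_le {a : ℝ} (ha0 : 0 ≤ a) (ha : ∀ w, L.referenceNorm (L.N.baseChange ℂ w) ≤ a * L.referenceNorm w)
    (i : ℕ) (w : ℂ ⊗[ℚ] V) : L.referenceNorm ((L.N.baseChange ℂ ^ i) w) ≤ a ^ i * L.referenceNorm w := by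
  induction i generalizing w with
  | zero => rw [pow_zero, pow_zero, Module.End.one_apply, one_mul]
  | succ i ih =>
    rw [pow_succ, Module.End.mul_apply]
    calc L.referenceNorm ((L.N.baseChange ℂ ^ i) (L.N.baseChange ℂ w)) ≤ a ^ i * L.referenceNorm (L.N.baseChange ℂ w) := ih _
      _ ≤ a ^ i * (a * L.referenceNorm w) := mul_le_mul_of_nonneg_left (ha w) (pow_nonneg ha0 _)
      _ = a ^ (i + 1) * L.referenceNorm w := by ring

/-- The norm of one term of the exponential series: `|(i!)⁻¹ • (cN)^{i+j} w|₀ ≤ ‖c‖^{i+j} a^{i+j} |w|₀`. [folklore] -/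
private theorem referenceNorm_term_le {a : ℝ} (ha0 : 0 ≤ a) (ha : ∀ w, L.referenceNorm (L.N.baseChange ℂ w) ≤ a * L.referenceNorm w)
    (i m : ℕ) (c : ℂ) (w : ℂ ⊗[ℚ] V) :
    L.referenceNorm (((i.factorial : ℚ)⁻¹ • (c • L.N.baseChange ℂ) ^ m) w) ≤ (‖c‖ * a) ^ m * L.referenceNorm w := by
  set P := L.deltaSplit.sharpPolarization L.isSplitOverR_deltaSplit with hP_def
  have hq : ‖(((i.factorial : ℚ)⁻¹ : ℚ) : ℂ)‖ ≤ 1 := by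
    rw [Rat.cast_inv, Rat.cast_natCast, norm_inv, Complex.norm_natCast]
    exact inv_le_one_of_one_le₀ (by exact_mod_cast Nat.one_le_of_lt (Nat.factorial_pos i))
  rw [LinearMap.smul_apply, smul_pow, LinearMap.smul_apply, ← Rat.cast_smul_eq_qsmul ℂ, L.referenceNorm_eq, P.hodgeNorm_smul,
    P.hodgeNorm_smul, norm_pow, ← L.referenceNorm_eq]
  calc ‖(((i.factorial : ℚ)⁻¹ : ℚ) : ℂ)‖ * (‖c‖ ^ m * L.referenceNorm ((L.N.baseChange ℂ ^ m) w))
      ≤ 1 * (‖c‖ ^ m * (a ^ m * L.referenceNorm w)) :=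
        mul_le_mul hq (mul_le_mul_of_nonneg_left (L.referenceNorm_pow_N_apply_le ha0 ha m w) (pow_nonneg (norm_nonneg _) _))
          (mul_nonneg (pow_nonneg (norm_nonneg _) _) (L.referenceNorm_nonneg _)) zero_le_one
    _ = (‖c‖ * a) ^ m * L.referenceNorm w := by rw [mul_pow]; ring

/-- `(‖c‖ a)^m ≤ ((1 + a)(1 + ‖c‖))^d` for `m ≤ d`. [folklore] -/
private theorem norm_mul_pow_le {a : ℝ} (ha0 : 0 ≤ a) (c : ℂ) {m d : ℕ} (hmd : m ≤ d) :
    (‖c‖ * a) ^ m ≤ ((1 + a) * (1 + ‖c‖)) ^ d := by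
  have h1 : ‖c‖ * a ≤ (1 + a) * (1 + ‖c‖) := by nlinarith [norm_nonneg c]
  have h2 : 1 ≤ (1 + a) * (1 + ‖c‖) := by nlinarith [norm_nonneg c]
  exact (pow_le_pow_left₀ (mul_nonneg (norm_nonneg _) ha0) h1 m).trans (pow_le_pow_right₀ h2 hmd)

/-! ## §1 The exponential of the monodromy logarithm has polynomial size in the fixed norm -/

/-- **«`exp(zN)` is of polynomial size»: there are `M ≥ 0` and `d` with `|exp(cN) w|₀ ≤ M (1 + ‖c‖)^d |w|₀` for all `c ∈ ℂ`,
`w ∈ V_ℂ`** (`exp(cN) = Σ_{i<d} cⁱNⁱ/i!`, `N^d = 0`). [cite: CattaniDeligneKaplan1995, 2.18 (p. 492) and 4.9 ("of polynomial size")] -/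
theorem exists_referenceNorm_exp_smul_N_le :
    ∃ M : ℝ, 0 ≤ M ∧ ∃ d : ℕ, ∀ (c : ℂ) (w : ℂ ⊗[ℚ] V),
      L.referenceNorm (IsNilpotent.exp (c • L.N.baseChange ℂ) w) ≤ M * (1 + ‖c‖) ^ d * L.referenceNorm w := by
  classical
  set P := L.deltaSplit.sharpPolarization L.isSplitOverR_deltaSplit with hP_def
  obtain ⟨a, ha0, ha⟩ := P.exists_hodgeNorm_apply_le (L.N.baseChange ℂ)
  obtain ⟨d, hd⟩ := L.isNilpotent_N_baseChange
  refine ⟨d * (1 + a) ^ d, by positivity, d, fun c w => ?_⟩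
  have hcd : (c • L.N.baseChange ℂ) ^ d = 0 := by rw [smul_pow, hd, smul_zero]
  rw [IsNilpotent.exp_eq_sum hcd, LinearMap.sum_apply]
  refine (P.hodgeNorm_sum_le _ _).trans ?_
  have hterm : ∀ i ∈ Finset.range d, P.hodgeNorm (((i.factorial : ℚ)⁻¹ • (c • L.N.baseChange ℂ) ^ i) w) ≤
      ((1 + a) * (1 + ‖c‖)) ^ d * L.referenceNorm w := fun i hi =>
    (L.referenceNorm_term_le ha0 ha i i c w).trans
      (mul_le_mul_of_nonneg_right (norm_mul_pow_le ha0 c (Finset.mem_range.1 hi).le) (L.referenceNorm_nonneg _))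
  calc ∑ i ∈ Finset.range d, P.hodgeNorm (((i.factorial : ℚ)⁻¹ • (c • L.N.baseChange ℂ) ^ i) w)
      ≤ ∑ _i ∈ Finset.range d, ((1 + a) * (1 + ‖c‖)) ^ d * L.referenceNorm w := Finset.sum_le_sum hterm
    _ = d * (1 + a) ^ d * (1 + ‖c‖) ^ d * L.referenceNorm w := by
        rw [Finset.sum_const, Finset.card_range, nsmul_eq_mul, mul_pow]; ring

/-- **`|exp(cN) w − w|₀ ≤ M ‖c‖ (1 + ‖c‖)^d |N w|₀`** for all `c`, `w`: the displacement by `exp(cN)` is controlled by `N w`, polynomially in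
`‖c‖` (`exp(cN) w − w = Σ_{1≤i<d} cⁱNⁱw/i! = Σ_{i<d−1} c^{i+1} Nⁱ(Nw)/(i+1)!`). [cite: CattaniDeligneKaplan1995, 4.9 (p. 505) ("applying exp(−iτ₁(n)T₁), of polynomial size … and, by 4.8")] -/
theorem exists_referenceNorm_exp_smul_N_sub_le :
    ∃ M : ℝ, 0 ≤ M ∧ ∃ d : ℕ, ∀ (c : ℂ) (w : ℂ ⊗[ℚ] V),
      L.referenceNorm (IsNilpotent.exp (c • L.N.baseChange ℂ) w - w) ≤ M * ‖c‖ * (1 + ‖c‖) ^ d * L.referenceNorm (L.N.baseChange ℂ w) := by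
  classical
  set P := L.deltaSplit.sharpPolarization L.isSplitOverR_deltaSplit with hP_def
  obtain ⟨a, ha0, ha⟩ := P.exists_hodgeNorm_apply_le (L.N.baseChange ℂ)
  obtain ⟨d, hd⟩ := L.isNilpotent_N_baseChange
  cases d with
  | zero =>
    -- `N^0 = 1 = 0`: the space is trivial
    refine ⟨0, le_rfl, 0, fun c w => ?_⟩
    have hw : w = 0 := by
      have h := LinearMap.congr_fun hd w
      rwa [pow_zero, Module.End.one_apply, LinearMap.zero_apply] at h
    have h0 : L.referenceNorm (IsNilpotent.exp (c • L.N.baseChange ℂ) w - w) = 0 := by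
      rw [L.referenceNorm_eq_zero_iff, hw, map_zero, sub_zero]
    rw [h0, zero_mul, zero_mul, zero_mul]
  | succ d =>
    refine ⟨d * (1 + a) ^ d, by positivity, d, fun c w => ?_⟩
    have hcd : (c • L.N.baseChange ℂ) ^ (d + 1) = 0 := by rw [smul_pow, hd, smul_zero]
    have hsplit : IsNilpotent.exp (c • L.N.baseChange ℂ) w - w =
        ∑ i ∈ Finset.range d, (((i + 1).factorial : ℚ)⁻¹ • (c • L.N.baseChange ℂ) ^ (i + 1)) w := by
      rw [IsNilpotent.exp_eq_sum hcd, LinearMap.sum_apply, Finset.sum_range_succ', pow_zero, Nat.factorial_zero, Nat.cast_one,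
        inv_one, one_smul, Module.End.one_apply, add_sub_cancel_right]
    rw [hsplit]
    refine (P.hodgeNorm_sum_le _ _).trans ?_
    -- each term: `(cN)^{i+1} w = c^{i+1} • N^i (N w)` up to the order of composition
    have hterm : ∀ i ∈ Finset.range d, P.hodgeNorm ((((i + 1).factorial : ℚ)⁻¹ • (c • L.N.baseChange ℂ) ^ (i + 1)) w) ≤
        ‖c‖ * ((1 + a) * (1 + ‖c‖)) ^ d * L.referenceNorm (L.N.baseChange ℂ w) := by
      intro i hi
      have e : (((i + 1).factorial : ℚ)⁻¹ • (c • L.N.baseChange ℂ) ^ (i + 1)) w =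
          c • ((((i + 1).factorial : ℚ)⁻¹ • (c • L.N.baseChange ℂ) ^ i) (L.N.baseChange ℂ w)) := by
        rw [LinearMap.smul_apply, LinearMap.smul_apply, pow_succ, Module.End.mul_apply, LinearMap.smul_apply, map_smul,
          smul_comm]
      rw [e, P.hodgeNorm_smul, ← L.referenceNorm_eq]
      calc ‖c‖ * L.referenceNorm ((((i + 1).factorial : ℚ)⁻¹ • (c • L.N.baseChange ℂ) ^ i) (L.N.baseChange ℂ w))
          ≤ ‖c‖ * ((‖c‖ * a) ^ i * L.referenceNorm (L.N.baseChange ℂ w)) :=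
            mul_le_mul_of_nonneg_left (L.referenceNorm_term_le ha0 ha (i + 1) i c _) (norm_nonneg _)
        _ ≤ ‖c‖ * (((1 + a) * (1 + ‖c‖)) ^ d * L.referenceNorm (L.N.baseChange ℂ w)) :=
            mul_le_mul_of_nonneg_left (mul_le_mul_of_nonneg_right (norm_mul_pow_le ha0 c (Finset.mem_range.1 hi).le)
              (L.referenceNorm_nonneg _)) (norm_nonneg _)
        _ = ‖c‖ * ((1 + a) * (1 + ‖c‖)) ^ d * L.referenceNorm (L.N.baseChange ℂ w) := by ring
    calc ∑ i ∈ Finset.range d, P.hodgeNorm ((((i + 1).factorial : ℚ)⁻¹ • (c • L.N.baseChange ℂ) ^ (i + 1)) w)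
        ≤ ∑ _i ∈ Finset.range d, ‖c‖ * ((1 + a) * (1 + ‖c‖)) ^ d * L.referenceNorm (L.N.baseChange ℂ w) := Finset.sum_le_sum hterm
      _ = d * (1 + a) ^ d * ‖c‖ * (1 + ‖c‖) ^ d * L.referenceNorm (L.N.baseChange ℂ w) := by
          rw [Finset.sum_const, Finset.card_range, nsmul_eq_mul, mul_pow]; ring

/-- **`exp(cN) w = w` when `N w = 0`** (every `c ∈ ℂ`). [cite: CattaniDeligneKaplan1995, 4.9 (p. 505) and 2.7 (2.7.2)] -/
theorem exp_smul_N_apply_of_N_apply_eq_zero (c : ℂ) {w : ℂ ⊗[ℚ] V} (hw : L.N.baseChange ℂ w = 0) :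
    IsNilpotent.exp (c • L.N.baseChange ℂ) w = w := by
  obtain ⟨M, -, d, h⟩ := L.exists_referenceNorm_exp_smul_N_sub_le
  have h1 := h c w
  rw [hw, (L.referenceNorm_eq_zero_iff _).2 rfl, mul_zero] at h1
  exact sub_eq_zero.1 ((L.referenceNorm_eq_zero_iff _).1 (le_antisymm h1 (L.referenceNorm_nonneg _)))

/-! ## §2 2.16 Remark (ii): the fixed norm and the Hodge norm at `θ(z)` differ by at most a power of `Im z` (for `|Re z| ≤ R`) -/

/-- **`‖w‖_{θ(z)} ≤ B (Im z)^n |w|₀` for all `w`, all `z` with `Im z > β`, `|Re z| ≤ R`** — «the ratio between a fixed metric and the Hodge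
metric is bounded by a power of `sup(y_j)`».  (`w = exp((Re z)N) v`, `‖exp((Re z)N) v‖_{θ(z)} ≤ (3/2)(Im z)^{(l−k)/2}|v|₀` for the top
weight `l`, `|v|₀ = |exp(−(Re z)N) w|₀ ≤ M(1+R)^d|w|₀`.) [cite: CattaniDeligneKaplan1995, Thm. 2.16 Remark (ii) (p. 492) and 3.9 (i) (p. 498)]
[cite: CattaniKaplanSchmid1987, §3 Cor. (3.7)] [cite: Schmid1973, Thm. (6.6) (cite only)] -/
theorem exists_forall_hodgeNorm_nilpotentOrbit_le_pow_mul_referenceNorm (R : ℝ) :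
    ∃ B : ℝ, 0 ≤ B ∧ ∃ n : ℕ, ∀ (z : ℂ) (hz : L.normThreshold < z.im), |z.re| ≤ R → ∀ w : ℂ ⊗[ℚ] V,
      (L.nilpotentOrbitPolarization z (L.orbitThreshold_lt_im hz)).hodgeNorm w ≤ B * z.im ^ n * L.referenceNorm w := by
  obtain ⟨M, hM0, d, hM⟩ := L.exists_referenceNorm_exp_smul_N_le
  obtain ⟨l, hl⟩ := L.toMixedHodgeStructure.exists_W_eq_top
  refine ⟨3 / 2 * M * (1 + |R|) ^ d, by positivity, (l - k).natAbs, fun z hz hRz w => ?_⟩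
  have hRz' : |z.re| ≤ |R| := hRz.trans (le_abs_self R)
  have hz0 : 0 < z.im := L.im_pos_of_normThreshold_lt hz
  have hy1 : 1 ≤ z.im := L.one_le_im_of_normThreshold_lt hz
  set v := IsNilpotent.exp (-((z.re : ℂ) • L.N.baseChange ℂ)) w with hv_def
  have hwv : IsNilpotent.exp ((z.re : ℂ) • L.N.baseChange ℂ) v = w := by
    rw [hv_def, ← Module.End.mul_apply, IsNilpotent.exp_mul_exp_neg_self (L.isNilpotent_N_baseChange.smul _), Module.End.one_apply]
  have hvW : v ∈ (L.W l).baseChange ℂ := by rw [hl, Submodule.baseChange_top]; exact Submodule.mem_top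
  have h1 := L.hodgeNorm_nilpotentOrbit_exp_le_of_mem_baseChange_W hz hvW
  rw [hwv] at h1
  have h2 : L.referenceNorm v ≤ M * (1 + |R|) ^ d * L.referenceNorm w := by
    have e : -((z.re : ℂ) • L.N.baseChange ℂ) = (-(z.re : ℂ)) • L.N.baseChange ℂ := (neg_smul _ _).symm
    have h := hM (-(z.re : ℂ)) w
    rw [hv_def, e]
    refine h.trans (mul_le_mul_of_nonneg_right (mul_le_mul_of_nonneg_left ?_ hM0) (L.referenceNorm_nonneg _))
    exact pow_le_pow_left₀ (by positivity) (by rw [norm_neg, Complex.norm_real, Real.norm_eq_abs]; linarith) d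
  have h3 : Real.sqrt z.im ^ (l - k) ≤ z.im ^ (l - k).natAbs := sqrt_zpow_le_pow_natAbs hy1 _
  calc (L.nilpotentOrbitPolarization z (L.orbitThreshold_lt_im hz)).hodgeNorm w ≤ 3 / 2 * (Real.sqrt z.im ^ (l - k) * L.referenceNorm v) := h1
    _ ≤ 3 / 2 * (z.im ^ (l - k).natAbs * (M * (1 + |R|) ^ d * L.referenceNorm w)) :=
        mul_le_mul_of_nonneg_left (mul_le_mul h3 h2 (L.referenceNorm_nonneg _) (by positivity)) (by norm_num)
    _ = 3 / 2 * M * (1 + |R|) ^ d * z.im ^ (l - k).natAbs * L.referenceNorm w := by ring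

/-- **`|w|₀ ≤ B (Im z)^n ‖w‖_{θ(z)}` for all `w`, all `z` with `Im z > β`, `|Re z| ≤ R`** (the other direction of 2.16 Remark (ii):
`v = exp(−(Re z)N) w = Σ_m π̂_m v`, `|π̂_m v|₀ ≤ 2 (Im z)^{(k−m)/2} ‖w‖_{θ(z)}`, `|w|₀ ≤ M(1+R)^d |v|₀`).
[cite: CattaniDeligneKaplan1995, Thm. 2.16 Remark (ii) (p. 492) and 3.9 (i) (p. 498)] [cite: CattaniKaplanSchmid1987, §3 Cor. (3.7)] -/
theorem exists_forall_referenceNorm_le_pow_mul_hodgeNorm_nilpotentOrbit (R : ℝ) :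
    ∃ B : ℝ, 0 ≤ B ∧ ∃ n : ℕ, ∀ (z : ℂ) (hz : L.normThreshold < z.im), |z.re| ≤ R → ∀ w : ℂ ⊗[ℚ] V,
      L.referenceNorm w ≤ B * z.im ^ n * (L.nilpotentOrbitPolarization z (L.orbitThreshold_lt_im hz)).hodgeNorm w := by
  classical
  set P := L.deltaSplit.sharpPolarization L.isSplitOverR_deltaSplit with hP_def
  obtain ⟨M, hM0, d, hM⟩ := L.exists_referenceNorm_exp_smul_N_le
  obtain ⟨s, hs⟩ := L.exists_weights_subset
  set n : ℕ := s.sup fun m => (k - m).natAbs with hn_def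
  refine ⟨M * (1 + |R|) ^ d * (s.card * 2), by positivity, n, fun z hz hRz w => ?_⟩
  have hz0 : 0 < z.im := L.im_pos_of_normThreshold_lt hz
  have hy1 : 1 ≤ z.im := L.one_le_im_of_normThreshold_lt hz
  have hRz' : |z.re| ≤ |R| := hRz.trans (le_abs_self R)
  set Pz := L.nilpotentOrbitPolarization z (L.orbitThreshold_lt_im hz) with hPz_def
  set v := IsNilpotent.exp (-((z.re : ℂ) • L.N.baseChange ℂ)) w with hv_def
  have hwv : IsNilpotent.exp ((z.re : ℂ) • L.N.baseChange ℂ) v = w := by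
    rw [hv_def, ← Module.End.mul_apply, IsNilpotent.exp_mul_exp_neg_self (L.isNilpotent_N_baseChange.smul _), Module.End.one_apply]
  -- each graded piece of `v` is bounded by the Hodge norm of `w`
  have hpiece : ∀ m ∈ s, L.referenceNorm (L.deltaSplit.toMixedHodgeStructure.deligneEProj m v) ≤ 2 * z.im ^ n * Pz.hodgeNorm w := by
    intro m hm
    have h := L.sqrt_zpow_mul_referenceNorm_deligneEProj_le hz m v
    rw [hwv] at h
    have hpos : 0 < Real.sqrt z.im ^ (m - k) := zpow_pos (Real.sqrt_pos.2 hz0) _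
    -- `|π̂_m v|₀ ≤ 2 (√y)^{k−m} ‖w‖`
    have h1 : L.referenceNorm (L.deltaSplit.toMixedHodgeStructure.deligneEProj m v) ≤ 2 * (Real.sqrt z.im ^ (k - m) * Pz.hodgeNorm w) := by
      have h2 : Real.sqrt z.im ^ (m - k) * L.referenceNorm (L.deltaSplit.toMixedHodgeStructure.deligneEProj m v) ≤ 2 * Pz.hodgeNorm w := by
        linarith
      have h3 : L.referenceNorm (L.deltaSplit.toMixedHodgeStructure.deligneEProj m v) ≤ 2 * Pz.hodgeNorm w / Real.sqrt z.im ^ (m - k) :=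
        (le_div_iff₀' hpos).2 h2
      rw [show k - m = -(m - k) by ring, zpow_neg]
      calc L.referenceNorm (L.deltaSplit.toMixedHodgeStructure.deligneEProj m v) ≤ 2 * Pz.hodgeNorm w / Real.sqrt z.im ^ (m - k) := h3
        _ = 2 * ((Real.sqrt z.im ^ (m - k))⁻¹ * Pz.hodgeNorm w) := by ring
    have h4 : Real.sqrt z.im ^ (k - m) ≤ z.im ^ n :=
      (sqrt_zpow_le_pow_natAbs hy1 _).trans (pow_le_pow_right₀ hy1 (Finset.le_sup (f := fun m => (k - m).natAbs) hm))
    calc L.referenceNorm (L.deltaSplit.toMixedHodgeStructure.deligneEProj m v) ≤ 2 * (Real.sqrt z.im ^ (k - m) * Pz.hodgeNorm w) := h1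
      _ ≤ 2 * (z.im ^ n * Pz.hodgeNorm w) :=
          mul_le_mul_of_nonneg_left (mul_le_mul_of_nonneg_right h4 (HodgeStructure.Polarization.hodgeNorm_nonneg _ _)) (by norm_num)
      _ = 2 * z.im ^ n * Pz.hodgeNorm w := by ring
  -- sum over the grading
  have hv : L.referenceNorm v ≤ s.card * 2 * z.im ^ n * Pz.hodgeNorm w := by
    conv_lhs => rw [← L.deltaSplit.toMixedHodgeStructure.sum_deligneEProj_apply s hs v]
    rw [L.referenceNorm_eq]
    refine (P.hodgeNorm_sum_le _ _).trans ?_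
    calc ∑ m ∈ s, P.hodgeNorm (L.deltaSplit.toMixedHodgeStructure.deligneEProj m v) ≤ ∑ _m ∈ s, 2 * z.im ^ n * Pz.hodgeNorm w :=
          Finset.sum_le_sum fun m hm => by rw [← L.referenceNorm_eq]; exact hpiece m hm
      _ = s.card * 2 * z.im ^ n * Pz.hodgeNorm w := by rw [Finset.sum_const, nsmul_eq_mul]; ring
  -- transport back by `exp((Re z)N)`
  have hw : L.referenceNorm w ≤ M * (1 + |R|) ^ d * L.referenceNorm v := by
    have h := hM (z.re : ℂ) v
    rw [hwv] at h
    refine h.trans (mul_le_mul_of_nonneg_right (mul_le_mul_of_nonneg_left ?_ hM0) (L.referenceNorm_nonneg _))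
    exact pow_le_pow_left₀ (by positivity) (by rw [Complex.norm_real, Real.norm_eq_abs]; linarith) d
  calc L.referenceNorm w ≤ M * (1 + |R|) ^ d * L.referenceNorm v := hw
    _ ≤ M * (1 + |R|) ^ d * (s.card * 2 * z.im ^ n * Pz.hodgeNorm w) := mul_le_mul_of_nonneg_left hv (by positivity)
    _ = M * (1 + |R|) ^ d * (s.card * 2) * z.im ^ n * Pz.hodgeNorm w := by ring

/-- **Uniform equivalence of the norms at the bounded points `z' = x₀ + iA`, `|x₀| ≤ R`** («`z(n) − iτ₁(n)θ¹` remains bounded and the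
corresponding Hodge filtrations remain in a compact set»): `‖w‖_{θ(z')} ≤ C|w|₀` and `|w|₀ ≤ C‖w‖_{θ(z')}` with ONE constant `C` for all
such `z'` (given `A > β`, `R`). [cite: CattaniDeligneKaplan1995, 4.9 (p. 505)] [cite: CattaniKaplanSchmid1987, §3 Cor. (3.6)] -/
theorem exists_forall_hodgeNorm_nilpotentOrbit_le_and_referenceNorm_le (R A : ℝ) (hA : L.normThreshold < A) :
    ∃ C : ℝ, 0 ≤ C ∧ ∀ (z : ℂ) (hz : L.normThreshold < z.im), |z.re| ≤ R → z.im = A → ∀ w : ℂ ⊗[ℚ] V,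
      (L.nilpotentOrbitPolarization z (L.orbitThreshold_lt_im hz)).hodgeNorm w ≤ C * L.referenceNorm w ∧
        L.referenceNorm w ≤ C * (L.nilpotentOrbitPolarization z (L.orbitThreshold_lt_im hz)).hodgeNorm w := by
  obtain ⟨B₁, hB₁, n₁, h₁⟩ := L.exists_forall_hodgeNorm_nilpotentOrbit_le_pow_mul_referenceNorm R
  obtain ⟨B₂, hB₂, n₂, h₂⟩ := L.exists_forall_referenceNorm_le_pow_mul_hodgeNorm_nilpotentOrbit R
  have hA0 : 0 ≤ A := (L.normThreshold_pos.trans hA).le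
  refine ⟨max (B₁ * A ^ n₁) (B₂ * A ^ n₂), by positivity, fun z hz hRz hzA w => ⟨?_, ?_⟩⟩
  · have h := h₁ z hz hRz w
    rw [hzA] at h
    exact h.trans (mul_le_mul_of_nonneg_right (le_max_left _ _) (L.referenceNorm_nonneg _))
  · have h := h₂ z hz hRz w
    rw [hzA] at h
    exact h.trans (mul_le_mul_of_nonneg_right (le_max_right _ _) (HodgeStructure.Polarization.hodgeNorm_nonneg _ _))

/-! ## §3 CDK 4.9 at `d = 1`: transfer of an approximate class from `θ(z)` to the bounded point `θ(z')`, `z' = Re z + iA` -/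

/-- **`θ(z')^p = exp((z' − z)N)·θ(z)^p`**: the orbit is an orbit. [cite: CattaniDeligneKaplan1995, 4.9 (p. 505) ("applying exp(−iτ₁(n)T₁)")] -/
theorem nilpotentOrbit_F_eq_map_exp_sub {z z' : ℂ} (hz : L.orbitThreshold < z.im) (hz' : L.orbitThreshold < z'.im) (p : ℤ) :
    (L.nilpotentOrbit z' hz').F p = ((L.nilpotentOrbit z hz).F p).map (IsNilpotent.exp ((z' - z) • L.N.baseChange ℂ)) := by
  have hc : Commute ((z' - z) • L.N.baseChange ℂ) (z • L.N.baseChange ℂ) :=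
    ((Commute.refl (L.N.baseChange ℂ)).smul_left _).smul_right _
  rw [L.nilpotentOrbit_F, L.nilpotentOrbit_F, ← Submodule.map_comp, ← Module.End.mul_eq_comp,
    ← IsNilpotent.exp_add_of_commute hc (L.isNilpotent_N_baseChange.smul _) (L.isNilpotent_N_baseChange.smul _), ← add_smul,
    sub_add_cancel]

/-- `exp((z' − z)N) f ∈ F^pθ(z')` for `f ∈ F^pθ(z)`. [cite: CattaniDeligneKaplan1995, 4.9 (p. 505)] -/
theorem exp_sub_smul_N_apply_mem_nilpotentOrbit_F {z z' : ℂ} (hz : L.orbitThreshold < z.im) (hz' : L.orbitThreshold < z'.im) {p : ℤ}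
    {f : ℂ ⊗[ℚ] V} (hf : f ∈ (L.nilpotentOrbit z hz).F p) :
    IsNilpotent.exp ((z' - z) • L.N.baseChange ℂ) f ∈ (L.nilpotentOrbit z' hz').F p := by
  rw [L.nilpotentOrbit_F_eq_map_exp_sub hz hz']
  exact Submodule.mem_map_of_mem hf

/-- `(1 + y)^d ≤ 2^d y^d` for `y ≥ 1`. [folklore] -/
private theorem one_add_pow_le {y : ℝ} (hy : 1 ≤ y) (d : ℕ) : (1 + y) ^ d ≤ 2 ^ d * y ^ d := by
  rw [← mul_pow]; exact pow_le_pow_left₀ (by linarith) (by linarith) d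

/-- **THE TRANSFER (CDK 4.9 at `d = 1`).**  For `R` there are `B ≥ 0` and `n` such that for every `z` with `Im z > β`, `|Re z| ≤ R`, every
`z'` with `Re z' = Re z`, `0 < Im z' ≤ Im z`, and all `x, f ∈ V_ℂ`:
**`|x − exp((z' − z)N) f|₀ ≤ B (Im z)^n (‖x − f‖_{θ(z)} + ‖N x‖_{θ(z)})`.**
With `f ∈ F^pθ(z)` close to `x` and `‖N x‖_{θ(z)}` small (CDK 4.8), `exp((z' − z)N) f ∈ F^pθ(z')` is close to `x` IN THE FIXED NORM, up to
the polynomial factor: «Applying `exp(−iτ₁(n)T₁)`, of polynomial size … and, by 4.8, `u(n) ∼_z Φ⁰(z(n) − iτ₁(n)θ¹)`».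
(`x − e f = −(e x − x) + e(x − f)`, §1 with `‖z' − z‖ = Im z − Im z' ≤ Im z`, §2.) [cite: CattaniDeligneKaplan1995, 4.9 (p. 505) and Thm. 2.16 Remark (ii) (p. 492)] -/
theorem exists_forall_referenceNorm_sub_exp_apply_le (R : ℝ) :
    ∃ B : ℝ, 0 ≤ B ∧ ∃ n : ℕ, ∀ (z : ℂ) (hz : L.normThreshold < z.im), |z.re| ≤ R → ∀ z' : ℂ, z'.re = z.re → 0 < z'.im → z'.im ≤ z.im →
      ∀ x f : ℂ ⊗[ℚ] V, L.referenceNorm (x - IsNilpotent.exp ((z' - z) • L.N.baseChange ℂ) f) ≤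
        B * z.im ^ n * ((L.nilpotentOrbitPolarization z (L.orbitThreshold_lt_im hz)).hodgeNorm (x - f) +
          (L.nilpotentOrbitPolarization z (L.orbitThreshold_lt_im hz)).hodgeNorm (L.N.baseChange ℂ x)) := by
  set P := L.deltaSplit.sharpPolarization L.isSplitOverR_deltaSplit with hP_def
  obtain ⟨M₁, hM₁, d₁, h₁⟩ := L.exists_referenceNorm_exp_smul_N_le
  obtain ⟨M₂, hM₂, d₂, h₂⟩ := L.exists_referenceNorm_exp_smul_N_sub_le
  obtain ⟨B', hB', n', h'⟩ := L.exists_forall_referenceNorm_le_pow_mul_hodgeNorm_nilpotentOrbit R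
  refine ⟨(M₁ * 2 ^ d₁ + M₂ * 2 ^ d₂) * B', by positivity, 1 + d₁ + d₂ + n', fun z hz hRz z' hre hz'0 hz'le x f => ?_⟩
  have hz0 : 0 < z.im := L.im_pos_of_normThreshold_lt hz
  have hy1 : 1 ≤ z.im := L.one_le_im_of_normThreshold_lt hz
  set Pz := L.nilpotentOrbitPolarization z (L.orbitThreshold_lt_im hz) with hPz_def
  set c : ℂ := z' - z with hc_def
  set y := z.im with hy_def
  -- `‖c‖ = Im z − Im z' ≤ y`
  have hc : ‖c‖ ≤ y := by
    have e : c = ((z'.im - z.im : ℝ) : ℂ) * Complex.I := by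
      apply Complex.ext <;> simp [hc_def, hre]
    rw [e, norm_mul, Complex.norm_I, mul_one, Complex.norm_real, Real.norm_eq_abs, abs_sub_comm, abs_of_nonneg (by linarith)]
    linarith
  have hc1 : (1 + ‖c‖) ^ d₁ ≤ 2 ^ d₁ * y ^ d₁ :=
    (pow_le_pow_left₀ (by positivity) (by linarith : 1 + ‖c‖ ≤ 1 + y) d₁).trans (one_add_pow_le hy1 d₁)
  have hc2 : ‖c‖ * (1 + ‖c‖) ^ d₂ ≤ y * (2 ^ d₂ * y ^ d₂) :=
    mul_le_mul hc ((pow_le_pow_left₀ (by positivity) (by linarith : 1 + ‖c‖ ≤ 1 + y) d₂).trans (one_add_pow_le hy1 d₂))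
      (by positivity) (by linarith)
  -- the two pieces
  have hA : L.referenceNorm (IsNilpotent.exp (c • L.N.baseChange ℂ) (x - f)) ≤ M₁ * 2 ^ d₁ * B' * y ^ (d₁ + n') * Pz.hodgeNorm (x - f) := by
    calc L.referenceNorm (IsNilpotent.exp (c • L.N.baseChange ℂ) (x - f)) ≤ M₁ * (1 + ‖c‖) ^ d₁ * L.referenceNorm (x - f) := h₁ c _
      _ ≤ M₁ * (2 ^ d₁ * y ^ d₁) * (B' * y ^ n' * Pz.hodgeNorm (x - f)) :=
          mul_le_mul (mul_le_mul_of_nonneg_left hc1 hM₁) (h' z hz hRz _) (L.referenceNorm_nonneg _) (by positivity)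
      _ = M₁ * 2 ^ d₁ * B' * y ^ (d₁ + n') * Pz.hodgeNorm (x - f) := by rw [pow_add]; ring
  have hB : L.referenceNorm (IsNilpotent.exp (c • L.N.baseChange ℂ) x - x) ≤
      M₂ * 2 ^ d₂ * B' * y ^ (1 + d₂ + n') * Pz.hodgeNorm (L.N.baseChange ℂ x) := by
    calc L.referenceNorm (IsNilpotent.exp (c • L.N.baseChange ℂ) x - x) ≤ M₂ * ‖c‖ * (1 + ‖c‖) ^ d₂ * L.referenceNorm (L.N.baseChange ℂ x) :=
          h₂ c x
      _ = M₂ * (‖c‖ * (1 + ‖c‖) ^ d₂) * L.referenceNorm (L.N.baseChange ℂ x) := by ring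
      _ ≤ M₂ * (y * (2 ^ d₂ * y ^ d₂)) * (B' * y ^ n' * Pz.hodgeNorm (L.N.baseChange ℂ x)) :=
          mul_le_mul (mul_le_mul_of_nonneg_left hc2 hM₂) (h' z hz hRz _) (L.referenceNorm_nonneg _) (by positivity)
      _ = M₂ * 2 ^ d₂ * B' * y ^ (1 + d₂ + n') * Pz.hodgeNorm (L.N.baseChange ℂ x) := by rw [pow_add, pow_add, pow_one]; ring
  -- domination of the exponents by `n = 1 + d₁ + d₂ + n'`
  have hpow1 : y ^ (d₁ + n') ≤ y ^ (1 + d₁ + d₂ + n') := pow_le_pow_right₀ hy1 (by omega)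
  have hpow2 : y ^ (1 + d₂ + n') ≤ y ^ (1 + d₁ + d₂ + n') := pow_le_pow_right₀ hy1 (by omega)
  have e : x - IsNilpotent.exp (c • L.N.baseChange ℂ) f = IsNilpotent.exp (c • L.N.baseChange ℂ) (x - f) - (IsNilpotent.exp (c • L.N.baseChange ℂ) x - x) := by
    rw [map_sub]; abel
  rw [e, L.referenceNorm_eq]
  refine (P.hodgeNorm_sub_le _ _).trans ?_
  rw [← L.referenceNorm_eq, ← L.referenceNorm_eq]
  have h0f := Pz.hodgeNorm_nonneg (x - f)
  have h0N := Pz.hodgeNorm_nonneg (L.N.baseChange ℂ x)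
  calc L.referenceNorm (IsNilpotent.exp (c • L.N.baseChange ℂ) (x - f)) + L.referenceNorm (IsNilpotent.exp (c • L.N.baseChange ℂ) x - x)
      ≤ M₁ * 2 ^ d₁ * B' * y ^ (d₁ + n') * Pz.hodgeNorm (x - f) + M₂ * 2 ^ d₂ * B' * y ^ (1 + d₂ + n') * Pz.hodgeNorm (L.N.baseChange ℂ x) :=
        add_le_add hA hB
    _ ≤ M₁ * 2 ^ d₁ * B' * y ^ (1 + d₁ + d₂ + n') * Pz.hodgeNorm (x - f) +
          M₂ * 2 ^ d₂ * B' * y ^ (1 + d₁ + d₂ + n') * Pz.hodgeNorm (L.N.baseChange ℂ x) := by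
        gcongr
    _ ≤ (M₁ * 2 ^ d₁ + M₂ * 2 ^ d₂) * B' * y ^ (1 + d₁ + d₂ + n') * (Pz.hodgeNorm (x - f) + Pz.hodgeNorm (L.N.baseChange ℂ x)) := by
        nlinarith [mul_nonneg (mul_nonneg (mul_nonneg hM₁ (pow_nonneg zero_le_two d₁)) hB') (pow_nonneg hz0.le (1 + d₁ + d₂ + n')),
          mul_nonneg (mul_nonneg (mul_nonneg hM₂ (pow_nonneg zero_le_two d₂)) hB') (pow_nonneg hz0.le (1 + d₁ + d₂ + n'))]

/-- **The transfer for an `N`-invariant class** (`N x = 0`, the output of CDK 4.7/4.8 made exact): `|x − exp((z' − z)N) f|₀ ≤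
B (Im z)^n ‖x − f‖_{θ(z)}`. [cite: CattaniDeligneKaplan1995, 4.9 (p. 505)] -/
theorem exists_forall_referenceNorm_sub_exp_apply_le_of_N_apply_eq_zero (R : ℝ) :
    ∃ B : ℝ, 0 ≤ B ∧ ∃ n : ℕ, ∀ (z : ℂ) (hz : L.normThreshold < z.im), |z.re| ≤ R → ∀ z' : ℂ, z'.re = z.re → 0 < z'.im → z'.im ≤ z.im →
      ∀ x f : ℂ ⊗[ℚ] V, L.N.baseChange ℂ x = 0 → L.referenceNorm (x - IsNilpotent.exp ((z' - z) • L.N.baseChange ℂ) f) ≤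
        B * z.im ^ n * (L.nilpotentOrbitPolarization z (L.orbitThreshold_lt_im hz)).hodgeNorm (x - f) := by
  obtain ⟨B, hB, n, h⟩ := L.exists_forall_referenceNorm_sub_exp_apply_le R
  refine ⟨B, hB, n, fun z hz hRz z' hre hz'0 hz'le x f hN => ?_⟩
  have h1 := h z hz hRz z' hre hz'0 hz'le x f
  rwa [hN, HodgeStructure.Polarization.hodgeNorm_zero, add_zero] at h1

/-! ## §4 Towards the limit Hodge filtration: `N x = 0`, `x` close to `F^pθ(z)` ⟹ `x` close to `F^p` in the fixed norm -/

/-- **For an `N`-invariant `x` and `f ∈ F^pθ(z)` (`Im z > β`, `|Re z| ≤ R`) there is `f₀ ∈ F^p` — namely `exp(−zN) f` — with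
`|x − f₀|₀ ≤ B (Im z)^n ‖x − f‖_{θ(z)}`** (`x − exp(−zN) f = exp(−zN)(x − f)`, `‖−z‖ ≤ R + Im z`; §1–§2).  The route to 2.16 (iii)
«`v` is in `F⁰` for some limiting Hodge filtration `F`»: for `N v = 0` all limiting filtrations `exp(zN)·F` contain `v` as soon as `F` does.
[cite: CattaniDeligneKaplan1995, Thm. 2.16 (iii) (p. 492) and 4.9 (p. 505)] -/
theorem exists_forall_exists_mem_F_referenceNorm_sub_le (R : ℝ) :
    ∃ B : ℝ, 0 ≤ B ∧ ∃ n : ℕ, ∀ (z : ℂ) (hz : L.normThreshold < z.im), |z.re| ≤ R → ∀ x : ℂ ⊗[ℚ] V, L.N.baseChange ℂ x = 0 →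
      ∀ (p : ℤ), ∀ f ∈ (L.nilpotentOrbit z (L.orbitThreshold_lt_im hz)).F p, ∃ f₀ ∈ L.F p,
        L.referenceNorm (x - f₀) ≤ B * z.im ^ n * (L.nilpotentOrbitPolarization z (L.orbitThreshold_lt_im hz)).hodgeNorm (x - f) := by
  obtain ⟨M, hM0, d, hM⟩ := L.exists_referenceNorm_exp_smul_N_le
  obtain ⟨B', hB', n', h'⟩ := L.exists_forall_referenceNorm_le_pow_mul_hodgeNorm_nilpotentOrbit R
  refine ⟨M * (2 + |R|) ^ d * B', by positivity, d + n', fun z hz hRz x hN p f hf => ?_⟩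
  have hRz' : |z.re| ≤ |R| := hRz.trans (le_abs_self R)
  have hz0 : 0 < z.im := L.im_pos_of_normThreshold_lt hz
  have hy1 : 1 ≤ z.im := L.one_le_im_of_normThreshold_lt hz
  set Pz := L.nilpotentOrbitPolarization z (L.orbitThreshold_lt_im hz) with hPz_def
  rw [L.nilpotentOrbit_F] at hf
  obtain ⟨g, hg, hgf⟩ := hf
  refine ⟨g, hg, ?_⟩
  -- `g = exp(−zN) f` and `x = exp(−zN) x`
  have hgx : x - g = IsNilpotent.exp (-(z • L.N.baseChange ℂ)) (x - f) := by
    have e1 : IsNilpotent.exp (-(z • L.N.baseChange ℂ)) f = g := by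
      rw [← hgf, ← Module.End.mul_apply, IsNilpotent.exp_neg_mul_exp_self (L.isNilpotent_N_baseChange.smul _), Module.End.one_apply]
    have e2 : IsNilpotent.exp (-(z • L.N.baseChange ℂ)) x = x := by
      rw [show -(z • L.N.baseChange ℂ) = (-z) • L.N.baseChange ℂ from (neg_smul _ _).symm]
      exact L.exp_smul_N_apply_of_N_apply_eq_zero (-z) hN
    rw [map_sub, e1, e2]
  have hnz : ‖-z‖ ≤ |R| + z.im := by
    rw [norm_neg]
    calc ‖z‖ ≤ |z.re| + |z.im| := Complex.norm_le_abs_re_add_abs_im z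
      _ ≤ |R| + z.im := by rw [abs_of_pos hz0]; linarith
  have hc1 : (1 + ‖-z‖) ^ d ≤ (2 + |R|) ^ d * z.im ^ d := by
    rw [← mul_pow]
    refine pow_le_pow_left₀ (by positivity) ?_ d
    nlinarith [abs_nonneg R]
  rw [hgx, show -(z • L.N.baseChange ℂ) = (-z) • L.N.baseChange ℂ from (neg_smul _ _).symm]
  calc L.referenceNorm (IsNilpotent.exp ((-z) • L.N.baseChange ℂ) (x - f)) ≤ M * (1 + ‖-z‖) ^ d * L.referenceNorm (x - f) := hM _ _
    _ ≤ M * ((2 + |R|) ^ d * z.im ^ d) * (B' * z.im ^ n' * Pz.hodgeNorm (x - f)) :=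
        mul_le_mul (mul_le_mul_of_nonneg_left hc1 hM0) (h' z hz hRz _) (L.referenceNorm_nonneg _) (by positivity)
    _ = M * (2 + |R|) ^ d * B' * z.im ^ (d + n') * Pz.hodgeNorm (x - f) := by rw [pow_add]; ring

/-- **`F^p` is closed in the fixed norm**: if for every `ε > 0` there is `f ∈ F^p` with `|x − f|₀ ≤ ε`, then `x ∈ F^p` (finite dimension).
[cite: CattaniDeligneKaplan1995, Thm. 2.16 (iii) (p. 492) and 4.9 ("taking a subsequence … we find that u is in the corresponding Φ⁰")] -/
theorem mem_F_of_forall_exists_referenceNorm_sub_le {p : ℤ} {x : ℂ ⊗[ℚ] V}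
    (h : ∀ ε : ℝ, 0 < ε → ∃ f ∈ L.F p, L.referenceNorm (x - f) ≤ ε) : x ∈ L.F p := by
  set P := L.deltaSplit.sharpPolarization L.isSplitOverR_deltaSplit with hP_def
  letI := P.hodgeNormedAddCommGroup
  letI := P.hodgeInnerProductSpace
  have hnorm : ∀ v : ℂ ⊗[ℚ] V, ‖v‖ = L.referenceNorm v := fun v => rfl
  have hclosed : IsClosed ((L.F p : Submodule ℂ (ℂ ⊗[ℚ] V)) : Set (ℂ ⊗[ℚ] V)) := Submodule.closed_of_finiteDimensional _
  have hmem : x ∈ closure ((L.F p : Submodule ℂ (ℂ ⊗[ℚ] V)) : Set (ℂ ⊗[ℚ] V)) := by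
    rw [Metric.mem_closure_iff]
    intro ε hε
    obtain ⟨f, hf, hle⟩ := h (ε / 2) (half_pos hε)
    exact ⟨f, hf, by rw [dist_eq_norm, hnorm]; linarith⟩
  rwa [hclosed.closure_eq] at hmem

/-- The same for the Hodge filtration of the orbit at a fixed point `θ(z')`: `F^pθ(z')` is closed in the fixed norm.
[cite: CattaniDeligneKaplan1995, 4.9 (p. 505)] -/
theorem mem_nilpotentOrbit_F_of_forall_exists_referenceNorm_sub_le {z' : ℂ} (hz' : L.orbitThreshold < z'.im) {p : ℤ} {x : ℂ ⊗[ℚ] V}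
    (h : ∀ ε : ℝ, 0 < ε → ∃ f ∈ (L.nilpotentOrbit z' hz').F p, L.referenceNorm (x - f) ≤ ε) : x ∈ (L.nilpotentOrbit z' hz').F p := by
  set P := L.deltaSplit.sharpPolarization L.isSplitOverR_deltaSplit with hP_def
  letI := P.hodgeNormedAddCommGroup
  letI := P.hodgeInnerProductSpace
  have hnorm : ∀ v : ℂ ⊗[ℚ] V, ‖v‖ = L.referenceNorm v := fun v => rfl
  have hclosed : IsClosed (((L.nilpotentOrbit z' hz').F p : Submodule ℂ (ℂ ⊗[ℚ] V)) : Set (ℂ ⊗[ℚ] V)) :=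
    Submodule.closed_of_finiteDimensional _
  have hmem : x ∈ closure (((L.nilpotentOrbit z' hz').F p : Submodule ℂ (ℂ ⊗[ℚ] V)) : Set (ℂ ⊗[ℚ] V)) := by
    rw [Metric.mem_closure_iff]
    intro ε hε
    obtain ⟨f, hf, hle⟩ := h (ε / 2) (half_pos hε)
    exact ⟨f, hf, by rw [dist_eq_norm, hnorm]; linarith⟩
  rwa [hclosed.closure_eq] at hmem

end PolarizedLimitMixedHodgeStructure

end HodgeTheory

end Literature.AlgebraicGeometry

end
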